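import Summits.NavierStokesRegularity.OSWSelfSimilar.SheetRRenewalScalar
import HarnessLib

/-!
# SHEET-ℝ, renewal route: THE SCALAR RENEWAL THEOREM AT A SIMPLE REAL ZERO `σ = a > 0` OF THE SYMBOL (time rescaling of the pole-at-`1` theorem)

HONEST FRAMING (cell ns-blowup GROUP B / zone Z3, case Z3-SR-SPEC EVEN half, P-list (P10)⁺; renewal route (R-b)/(R-c) of memo
`HOME/profile/cert/cert5/P9-P10-RENEWAL-DESIGN.md` v2; 0 kit; 1-D MODEL frame; not Euler/NS; «violates: none — MODEL»). WHAT THIS IS NOT: not NS; not a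
semigroup; no operator, no profile, no number of record moves. Generic scalar analysis; no definition, no named fact.

WHY. The tree's scalar renewal theorem `SheetRRenewalScalar.exists_uniform_renewal_const` (and the Bromwich/contour bricks
`Literature.Analysis.Convolution.RenewalPoleData.*` behind it) HARD-WIRE the simple zero of the symbol `E = 1 − 𝓛k` at `σ = 1` (the odd class: gauge
mode). On the EVEN zero-mass class the zero of record of the even Evans function sits at `σ = 1/2` (translation mode;
`SheetRSpectrumEvenEndToEnd.eigen_half_simple_of_record`). This file moves the zero to an ARBITRARY real `a > 0` WITHOUT re-opening the contour argument:

TIME RESCALING. With `c = a⁻¹`, `k̃(τ) = c·k(cτ)`, `m̃(t) = m(ct)`, `m̃₀(t) = m₀(ct)`: `m = m₀ + k ⋆ m` on `[0,∞)` iff `m̃ = m̃₀ + k̃ ⋆ m̃`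
(`hconv_rescale`), `𝓛k̃(σ) = 𝓛k(σ/c)` (`laplaceC_rescale`), so `Ẽ(σ) := E(σ/c)` is the symbol of `k̃`, has its simple zero at `σ = 1` with
`Ẽ′(1) = a·E′(a)`, and is zero-free on `{Re σ > −cβ₀} ∖ {1}`; `‖k̃‖, ‖k̃′‖ ≤ (c + c²)K e^{−cμt}`. Undoing the scaling in the conclusion of the pole-at-`1`
theorem gives

THE THEOREM (`exists_uniform_renewal_const_rate`). Let `k ∈ C¹(0,∞) ∩ C[0,∞)` with `‖k‖, ‖k′‖ ≤ Ke^{−μt}` (`μ > 0`), symbol `E = 1 − 𝓛k` on `Re σ > −μ` with NO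
zero in `{Re σ > −β₀} ∖ {a}` and a SIMPLE zero at `σ = a` (`a > 0`, `0 < β₀ ≤ μ`), and `0 < β′ < β₀`. There is `N′ ≥ 0` (depending on `k, E, a, β′` only) such
that for EVERY continuous datum `‖m₀(s)‖ ≤ C₀e^{−μ₀s}` (`μ₀ > β′`) and every continuous solution of `m = m₀ + k ⋆ m` on `[0,∞)`:
    `‖m(t) − E′(a)⁻¹·(∫₀^∞ e^{−as}m₀(s) ds)·e^{at}‖ ≤ C₀·(1 + ‖E′(a)⁻¹‖/(a + μ₀) + N′)·e^{−β′t}`   (`t ≥ 0`):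
growing mode `e^{at}` times the «adjoint pairing» `∫₀^∞e^{−as}m₀`, plus an exponentially decaying remainder, constant LINEAR in `C₀`.
Classical source for the statement at a general simple zero: Gripenberg–Londen–Staffans 1990 Ch. 7 Thm 2.1 (provenance only; everything is proved here
from the tree's `a = 1` case).
-/

noncomputable section

namespace Summit.NavierStokesRegularity.OSWSelfSimilar
namespace SheetRRenewalScalarRate

open _root_.MeasureTheory _root_.Set _root_.Filter _root_.Real _root_.Complex intervalIntegral
open scoped Topology
open Literature.Analysis.Complex Literature.Analysis.Convolution

variable {c : ℝ}

/-! ### §1 Time rescaling `t ↦ ct` (`c > 0`) of kernels, data, convolutions and Laplace transforms -/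

/-- Enlarging the constant of an exponential bound. [cite: Schiff1999, Definition 1.10] -/
theorem halfLineExpBound_mono_const {g : ℝ → ℂ} {G G' γ : ℝ} (h : HalfLineExpBound g G γ) (hG : G ≤ G') :
    HalfLineExpBound g G' γ :=
  ⟨h.continuous, fun t ht => (h.bound t ht).trans (mul_le_mul_of_nonneg_right hG (Real.exp_pos _).le)⟩

/-- The rescaled function `τ ↦ c·g(cτ)` is of exponential order `cγ` with constant `cG`. [cite: Schiff1999, Definition 1.10 / Theorem 1.27] -/
theorem halfLineExpBound_rescale {g : ℝ → ℂ} {G γ : ℝ} (h : HalfLineExpBound g G γ) (hc : 0 < c) :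
    HalfLineExpBound (fun τ : ℝ => (c : ℂ) * g (c * τ)) (c * G) (c * γ) := by
  refine ⟨continuous_const.mul (h.continuous.comp (continuous_const.mul continuous_id)), fun t ht => ?_⟩
  have hct : 0 ≤ c * t := mul_nonneg hc.le ht
  rw [norm_mul, Complex.norm_real, Real.norm_of_nonneg hc.le, mul_assoc]
  refine mul_le_mul_of_nonneg_left ?_ hc.le
  have := h.bound (c * t) hct
  rwa [show γ * (c * t) = c * γ * t by ring] at this

/-- Chain rule for the rescaled kernel: `(c·g(c·))′(t) = c·(c·g′(ct))`. [cite: Schiff1999, Theorem 1.27] -/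
theorem hasDerivAt_rescale {g g' : ℝ → ℂ} (hd : ∀ t : ℝ, 0 < t → HasDerivAt g (g' t) t) (hc : 0 < c) {t : ℝ} (ht : 0 < t) :
    HasDerivAt (fun τ : ℝ => (c : ℂ) * g (c * τ)) ((c : ℂ) * ((c : ℂ) * g' (c * t))) t := by
  have h1 : HasDerivAt (fun τ : ℝ => c * τ) c t := by simpa using (hasDerivAt_id t).const_mul c
  have h2 : HasDerivAt (fun τ : ℝ => g (c * τ)) (c • g' (c * t)) t := (hd (c * t) (mul_pos hc ht)).scomp t h1
  have h3 := h2.const_mul (c : ℂ)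
  simpa only [Complex.real_smul] using h3

/-- **Convolution under rescaling**: `(k̃ ⋆ m̃)(t) = (k ⋆ m)(ct)` for `k̃(τ) = c·k(cτ)`, `m̃(τ) = m(cτ)`. [cite: Schiff1999, Theorem 1.27 / §2.7] -/
theorem hconv_rescale (k m : ℝ → ℂ) (c t : ℝ) :
    hconv (fun τ : ℝ => (c : ℂ) * k (c * τ)) (fun τ : ℝ => m (c * τ)) t = hconv k m (c * t) := by
  simp only [hconv]
  have h1 : (∫ u in (0:ℝ)..t, (c : ℂ) * k (c * (t - u)) * m (c * u)) =
      (c : ℂ) * ∫ u in (0:ℝ)..t, k (c * t - c * u) * m (c * u) := by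
    rw [← intervalIntegral.integral_const_mul]
    refine intervalIntegral.integral_congr fun u _ => ?_
    simp only [mul_sub, mul_assoc]
  rw [h1]
  have h2 := intervalIntegral.smul_integral_comp_mul_left (f := fun v : ℝ => k (c * t - v) * m v) (a := (0:ℝ)) (b := t) c
  simp only [mul_zero] at h2
  rw [← h2, Complex.real_smul]

/-- **Laplace transform under rescaling**: `𝓛k̃(σ) = 𝓛k(σ/c)` for `k̃(τ) = c·k(cτ)`, `c > 0`. [cite: Schiff1999, Theorem 1.27] -/
theorem laplaceC_rescale (k : ℝ → ℂ) (hc : 0 < c) (s : ℂ) :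
    laplaceC (fun τ : ℝ => (c : ℂ) * k (c * τ)) s = laplaceC k (s / c) := by
  simp only [laplaceC]
  have hc' : (c : ℂ) ≠ 0 := by exact_mod_cast hc.ne'
  have h1 : (fun τ : ℝ => cexp (-(s * τ)) * ((c : ℂ) * k (c * τ))) =
      fun τ : ℝ => (c : ℂ) * (cexp (-(s / c * ((c * τ : ℝ) : ℂ))) * k (c * τ)) := by
    funext τ
    have : s / c * ((c * τ : ℝ) : ℂ) = s * τ := by push_cast; field_simp
    rw [this]; ring
  rw [h1, MeasureTheory.integral_const_mul]
  have h2 := MeasureTheory.integral_comp_mul_left_Ioi (fun v : ℝ => cexp (-(s / c * v)) * k v) 0 hc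
  simp only [mul_zero] at h2
  rw [h2, Complex.real_smul, Complex.ofReal_inv, mul_inv_cancel_left₀ hc']

/-- **The weighted mode integral under rescaling**: `∫₀^∞ e^{−s}m₀(cs) ds = a·∫₀^∞ e^{−av}m₀(v) dv` for `ac = 1`, `c > 0`. [cite: Schiff1999, Theorem 1.27] -/
theorem integral_exp_rescale (m₀ : ℝ → ℂ) {a : ℝ} (hc : 0 < c) (hac : a * c = 1) :
    (∫ s in Ioi (0 : ℝ), (Real.exp (-s) : ℂ) * m₀ (c * s)) =
      (a : ℂ) * ∫ v in Ioi (0 : ℝ), (Real.exp (-(a * v)) : ℂ) * m₀ v := by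
  have h1 : (fun s : ℝ => (Real.exp (-s) : ℂ) * m₀ (c * s)) =
      fun s : ℝ => (Real.exp (-(a * (c * s))) : ℂ) * m₀ (c * s) := by
    funext s
    rw [← mul_assoc, hac, one_mul]
  rw [h1]
  have h2 := MeasureTheory.integral_comp_mul_left_Ioi (fun v : ℝ => (Real.exp (-(a * v)) : ℂ) * m₀ v) 0 hc
  simp only [mul_zero] at h2
  have hca : c⁻¹ = a := by
    have : a = c⁻¹ := eq_inv_of_mul_eq_one_left hac
    exact this.symm
  rw [h2, Complex.real_smul, hca]

/-! ### §2 The symbol `E` near its zero: differentiability from the Laplace representation -/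

/-- `E` is complex-differentiable at every point of the half-plane `Re σ > −μ` on which `E = 1 − 𝓛k`. [cite: Schiff1999, Theorem 3.1 / 1.11] -/
theorem hasDerivAt_E {k : ℝ → ℂ} {E : ℂ → ℂ} {K μ : ℝ} (hk : HalfLineExpBound k K (-μ))
    (hE : ∀ s : ℂ, -μ < s.re → E s = 1 - laplaceC k s) {z : ℂ} (hz : -μ < z.re) : HasDerivAt E (deriv E z) z := by
  have hopen : IsOpen {s : ℂ | -μ < s.re} := isOpen_lt continuous_const Complex.continuous_re
  have hmem : {s : ℂ | -μ < s.re} ∈ 𝓝 z := hopen.mem_nhds hz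
  have hdiffL : DifferentiableAt ℂ (laplaceC k) z := (hk.differentiableOn_laplaceC z hz).differentiableAt hmem
  have hdiff1 : DifferentiableAt ℂ (fun s => 1 - laplaceC k s) z := (differentiableAt_const _).sub hdiffL
  have heq : E =ᶠ[𝓝 z] fun s => 1 - laplaceC k s := Filter.eventually_of_mem hmem fun s hs => hE s hs
  have hdiffE : DifferentiableAt ℂ E z := hdiff1.congr_of_eventuallyEq heq
  exact hdiffE.hasDerivAt

/-- The rescaled symbol `Ẽ(σ) = E(σ/c)` (`c > 0`, `ca = 1`) has derivative `E′(a)·a` at `σ = 1`. [cite: Schiff1999, Theorem 1.27] -/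
theorem hasDerivAt_E_rescale {k : ℝ → ℂ} {E : ℂ → ℂ} {K μ a : ℝ} (hk : HalfLineExpBound k K (-μ))
    (hE : ∀ s : ℂ, -μ < s.re → E s = 1 - laplaceC k s) (hμ : 0 < μ) (ha : 0 < a) (hc : 0 < c) (hca : c * a = 1) :
    HasDerivAt (fun s : ℂ => E (s / c)) (deriv E a * a) 1 := by
  have hc' : (c : ℂ) ≠ 0 := by exact_mod_cast hc.ne'
  have hone : (1 : ℂ) / (c : ℂ) = a := by
    rw [div_eq_iff hc', ← Complex.ofReal_mul, mul_comm, hca, Complex.ofReal_one]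
  have hEa : HasDerivAt E (deriv E a) a := hasDerivAt_E hk hE (by simp; linarith)
  have hdiv : HasDerivAt (fun s : ℂ => s / (c : ℂ)) (1 / (c : ℂ)) 1 := (hasDerivAt_id (1 : ℂ)).div_const _
  have h1 : (fun s : ℂ => s / (c : ℂ)) 1 = a := by simp only; exact hone
  rw [← h1] at hEa
  have hcomp := HasDerivAt.comp (1 : ℂ) hEa hdiv
  rw [h1, hone] at hcomp
  exact hcomp

/-! ### §3 The theorem at a simple real zero `a > 0` -/

/-- **UNIFORM SCALAR RENEWAL THEOREM AT A SIMPLE REAL ZERO `σ = a > 0`.** See the module docstring. 1-D MODEL frame; not NS.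
[cite: GripenbergLondenStaffans1990, Ch. 7 Thm 2.1] -/
theorem exists_uniform_renewal_const_rate {k k' : ℝ → ℂ} {E : ℂ → ℂ} {K μ β₀ β' a : ℝ} (ha : 0 < a)
    (hk : HalfLineExpBound k K (-μ)) (hk' : HalfLineExpBound k' K (-μ)) (hd : ∀ t : ℝ, 0 < t → HasDerivAt k (k' t) t)
    (hμ : 0 < μ) (hE : ∀ s : ℂ, -μ < s.re → E s = 1 - laplaceC k s) (hβ₀ : 0 < β₀) (hβ₀μ : β₀ ≤ μ)
    (hzero : ∀ s : ℂ, -β₀ < s.re → s ≠ a → E s ≠ 0) (hEa : E a = 0) (hE'a : deriv E a ≠ 0)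
    (hβ' : 0 < β') (hβ'β₀ : β' < β₀) :
    ∃ N' : ℝ, 0 ≤ N' ∧ ∀ (m₀ m : ℝ → ℂ) (C₀ μ₀ : ℝ), Continuous m₀ → (∀ s : ℝ, 0 ≤ s → ‖m₀ s‖ ≤ C₀ * Real.exp (-μ₀ * s)) →
      Continuous m → (∀ t : ℝ, 0 ≤ t → m t = m₀ t + hconv k m t) → β' < μ₀ → ∀ t : ℝ, 0 ≤ t →
        ‖m t - (deriv E a)⁻¹ * (∫ s in Ioi (0 : ℝ), (Real.exp (-(a * s)) : ℂ) * m₀ s) * (Real.exp (a * t) : ℂ)‖ ≤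
          C₀ * (1 + ‖(deriv E a)⁻¹‖ / (a + μ₀) + N') * Real.exp (-β' * t) := by
  -- the scale `c = a⁻¹`, kept opaque
  obtain ⟨c, hcdef⟩ : ∃ c : ℝ, c = a⁻¹ := ⟨_, rfl⟩
  have hc : 0 < c := by rw [hcdef]; exact inv_pos.2 ha
  have hca : c * a = 1 := by rw [hcdef]; exact inv_mul_cancel₀ ha.ne'
  have hac : a * c = 1 := by rw [mul_comm]; exact hca
  have ha' : (a : ℂ) ≠ 0 := by exact_mod_cast ha.ne'
  have hc' : (c : ℂ) ≠ 0 := by exact_mod_cast hc.ne'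
  have hac' : (a : ℂ) * (c : ℂ) = 1 := by exact_mod_cast hac
  have hK0 : 0 ≤ K := hk.nonneg
  -- rescaled kernel / derivative: exponential bounds with the common constant `(c + c²)K`, rate `cμ`
  have hKK : HalfLineExpBound (fun τ : ℝ => (c : ℂ) * k (c * τ)) ((c + c * c) * K) (-(c * μ)) := by
    have h1 := halfLineExpBound_rescale hk hc
    rw [show c * -μ = -(c * μ) by ring] at h1
    exact halfLineExpBound_mono_const h1 (by nlinarith)
  have hKK' : HalfLineExpBound (fun τ : ℝ => (c : ℂ) * ((c : ℂ) * k' (c * τ))) ((c + c * c) * K) (-(c * μ)) := by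
    have h0 := hk'.const_mul (c : ℂ)
    rw [Complex.norm_real, Real.norm_of_nonneg hc.le] at h0
    have h1 := halfLineExpBound_rescale h0 hc
    rw [show c * -μ = -(c * μ) by ring] at h1
    exact halfLineExpBound_mono_const h1 (by nlinarith)
  have hdd : ∀ t : ℝ, 0 < t →
      HasDerivAt (fun τ : ℝ => (c : ℂ) * k (c * τ)) ((fun τ : ℝ => (c : ℂ) * ((c : ℂ) * k' (c * τ))) t) t :=
    fun t ht => hasDerivAt_rescale hd hc ht
  have hμμ : 0 < c * μ := mul_pos hc hμ
  -- the rescaled symbol `Ẽ(σ) = E(σ/c)`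
  have hre : ∀ s : ℂ, (s / (c : ℂ)).re = s.re / c := fun s => Complex.div_ofReal_re s c
  have hEE : ∀ s : ℂ, -(c * μ) < s.re → (fun s : ℂ => E (s / c)) s = 1 - laplaceC (fun τ : ℝ => (c : ℂ) * k (c * τ)) s := by
    intro s hs
    have hs' : -μ < (s / (c : ℂ)).re := by
      rw [hre, lt_div_iff₀ hc]
      have : -μ * c = -(c * μ) := by ring
      rw [this]; exact hs
    simp only
    rw [hE _ hs', laplaceC_rescale k hc s]
  have hzeroEE : ∀ s : ℂ, -(c * β₀) < s.re → s ≠ 1 → (fun s : ℂ => E (s / c)) s ≠ 0 := by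
    intro s hs hs1
    have hs' : -β₀ < (s / (c : ℂ)).re := by
      rw [hre, lt_div_iff₀ hc]
      have : -β₀ * c = -(c * β₀) := by ring
      rw [this]; exact hs
    have hsa : s / (c : ℂ) ≠ a := by
      intro h
      apply hs1
      rw [div_eq_iff hc'] at h
      rw [h, hac']
    exact hzero _ hs' hsa
  have hone : (1 : ℂ) / (c : ℂ) = a := by
    rw [div_eq_iff hc', ← Complex.ofReal_mul, mul_comm, hca, Complex.ofReal_one]
  have hEE1 : (fun s : ℂ => E (s / c)) 1 = 0 := by
    simp only
    rw [hone]; exact hEa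
  have hderEE : deriv (fun s : ℂ => E (s / c)) 1 = deriv E a * a :=
    (hasDerivAt_E_rescale hk hE hμ ha hc hca).deriv
  have hEE'1 : deriv (fun s : ℂ => E (s / c)) 1 ≠ 0 := by
    rw [hderEE]; exact mul_ne_zero hE'a ha'
  -- the pole-at-`1` theorem for the rescaled data
  obtain ⟨N', hN'0, hN'⟩ := SheetRRenewalScalar.exists_uniform_renewal_const hKK hKK' hdd hμμ hEE (mul_pos hc hβ₀)
    (mul_le_mul_of_nonneg_left hβ₀μ hc.le) hzeroEE hEE1 hEE'1 (mul_pos hc hβ') (mul_lt_mul_of_pos_left hβ'β₀ hc)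
  refine ⟨N', hN'0, fun m₀ m C₀ μ₀ hm₀ hb₀ hm hren hβ'μ₀ t ht => ?_⟩
  -- rescaled datum and solution
  have hmm₀c : Continuous fun τ : ℝ => m₀ (c * τ) := hm₀.comp (continuous_const.mul continuous_id)
  have hmmc : Continuous fun τ : ℝ => m (c * τ) := hm.comp (continuous_const.mul continuous_id)
  have hbb₀ : ∀ s : ℝ, 0 ≤ s → ‖(fun τ : ℝ => m₀ (c * τ)) s‖ ≤ C₀ * Real.exp (-(c * μ₀) * s) := by
    intro s hs
    have h1 := hb₀ (c * s) (mul_nonneg hc.le hs)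
    rw [show -μ₀ * (c * s) = -(c * μ₀) * s by ring] at h1
    exact h1
  have hrren : ∀ τ : ℝ, 0 ≤ τ → (fun τ' : ℝ => m (c * τ')) τ =
      (fun τ' : ℝ => m₀ (c * τ')) τ + hconv (fun τ' : ℝ => (c : ℂ) * k (c * τ')) (fun τ' : ℝ => m (c * τ')) τ := by
    intro τ hτ
    simp only
    rw [hconv_rescale k m c τ]
    exact hren (c * τ) (mul_nonneg hc.le hτ)
  have key := hN' (fun τ : ℝ => m₀ (c * τ)) (fun τ : ℝ => m (c * τ)) C₀ (c * μ₀) hmm₀c hbb₀ hmmc hrren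
    (mul_lt_mul_of_pos_left hβ'μ₀ hc) (a * t) (mul_nonneg ha.le ht)
  beta_reduce at key
  -- undo the scaling
  have h1 : m (c * (a * t)) = m t := by rw [← mul_assoc, hca, one_mul]
  have h2 := integral_exp_rescale m₀ hc hac
  have h5 : -(c * β') * (a * t) = -β' * t := by
    rw [show -(c * β') * (a * t) = -β' * ((c * a) * t) by ring, hca, one_mul]
  rw [h1, h2, hderEE, h5] at key
  have h4 : (deriv E a * (a : ℂ))⁻¹ * ((a : ℂ) * ∫ v in Ioi (0 : ℝ), (Real.exp (-(a * v)) : ℂ) * m₀ v) =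
      (deriv E a)⁻¹ * ∫ v in Ioi (0 : ℝ), (Real.exp (-(a * v)) : ℂ) * m₀ v := by
    rw [mul_inv, mul_assoc, inv_mul_cancel_left₀ ha']
  rw [h4] at key
  have hμ₀ : 0 < a + μ₀ := by linarith
  have h6 : ‖(deriv E a * (a : ℂ))⁻¹‖ / (1 + c * μ₀) = ‖(deriv E a)⁻¹‖ / (a + μ₀) := by
    rw [mul_inv, norm_mul, norm_inv (a : ℂ), Complex.norm_real, Real.norm_of_nonneg ha.le, hcdef]
    field_simp
  rw [h6] at key
  exact key

end SheetRRenewalScalarRate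
end Summit.NavierStokesRegularity.OSWSelfSimilar

end
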